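import Literature.MathematicalPhysics.QuantumLattice.TranslationCoeffContinuation
import Literature.MathematicalPhysics.QuantumLattice.ReehSchliederSeparating
import Literature.MathematicalPhysics.QuantumLattice.FieldStrongContinuity
import HarnessLib

/-!
# The Reeh–Schlieder theorem for the causal complement of a bounded region, and
Streater–Wightman's Theorem 4-3 for bounded regions (proved)

Topic `Literature/MathematicalPhysics/QuantumLattice` (trunk T-AQFT). Streater–Wightman, Thm 4-2
(Reeh–Schlieder): the vacuum is cyclic for the polynomial algebra `𝒫(𝒪)` of *every* open set `𝒪`;
Thm 4-3: hence, if `𝒪'` is nonempty, `T ∈ 𝒫(𝒪)` and `TΨ₀ = 0` imply `T = 0`, in particular for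
every bounded `𝒪` (Remark 2). The tree records Thm 4-2 as the named fact
`Literature.Analysis.FunctionSpaces.reeh_schlieder` and proves Thm 4-3 from it
(`ReehSchliederSeparating`). This file **proves unconditionally** the case of Thm 4-2 that Thm 4-3
for bounded regions consumes — cyclicity of the vacuum for `𝒫(𝒪')`, `𝒪` bounded — and hence
Thm 4-3 for bounded `𝒪`:

* `IsWightmanQFT.dense_span_monomialVec_far` (**Reeh–Schlieder for far regions**): for `d ≥ 1`
  and every `R`, the vectors `φ(g₁)⋯φ(gₙ)Ω` with `gᵢ ∈ 𝒟`, `supp gᵢ ⊆ S_R = {|x⁰| + 2R < ‖x⃗‖}`,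
  span a dense subspace. Proof (a one-variable form of the analytic-continuation argument of
  Thm 4-2): if `χ ⊥` all of them and `g₁, …, gₙ ∈ 𝒟` are arbitrary, the matrix coefficient
  `u(a) = ⟪χ, U(a) φ(g₁)⋯φ(gₙ)Ω⟫ = ⟪χ, φ(g₁(· − a))⋯φ(gₙ(· − a))Ω⟫` (W2, `U_monomialVec`)
  vanishes for all `a` in the nonempty open set of translations carrying the supports into
  `S_R`; by the spectral condition W0 and
  `UnitaryRep.matrixCoeff_eq_zero_of_eqOn_isOpen` (`TranslationCoeffContinuation`: forward-tube
  continuation + S–W Thm 2-17) `u ≡ 0`, so `⟪χ, φ(g₁)⋯φ(gₙ)Ω⟫ = u(0) = 0`; by density of `𝒟` in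
  `𝒮` and the norm continuity of monomial vectors in each slot (the tree's
  `IsWightmanQFT.eq_zero_of_forall_inner_monomialVec_hasCompactSupport`, `FieldStrongContinuity`)
  this gives `χ = 0` (W4);
* `IsWightmanQFT.reeh_schlieder_causalComplement_of_isBounded`: the same for the causal
  complement `𝒪'` of a bounded `𝒪` (`S_R ⊆ 𝒪'`, `isSpacelikeSeparated_of_far`);
* `IsWightmanQFT.localPolynomial_eq_zero_of_isBounded` (**S–W Thm 4-3 with Remark 2,
  unconditional**): for bounded `𝒪`, `T ∈ 𝒫(𝒪)` and `TΨ₀ = 0` imply `T = 0` on `D` (the printed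
  proof (4-12), as in `reehSchlieder_separating_of_reeh_schlieder`, with the density above).

What is NOT here: Thm 4-2 for a general open set (it needs the `n`-variable tube; see the named
fact `reeh_schlieder`).

## References

* R. F. Streater, A. S. Wightman, *PCT, Spin and Statistics, and All That* (1964; Princeton
  2000 printing, pdf pp. 123–124), §4-2, Thms 4-2, 4-3 and Remark 2. [StreaterWightman1964]
  [StreaterWightman2001]
* H. Reeh, S. Schlieder, Nuovo Cimento 22 (1961) 1051–1068. [ReehSchlieder1961]

## Mathlib / tree

Used: `Set.Finite.isCompact_biUnion`, `Dense.eq_zero_of_inner_left`,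
`Submodule.topologicalClosure_eq_top_iff`, `tsupport_comp_subset_preimage`; from the tree
`WightmanData.monomialVec`, `IsWightmanQFT.U_monomialVec` (`WightmanFunctionsProofs`),
`IsWightmanQFT.eq_zero_of_forall_inner_monomialVec_hasCompactSupport` (`FieldStrongContinuity`),
`UnitaryRep.matrixCoeff_eq_zero_of_eqOn_isOpen` (`TranslationCoeffContinuation`),
`causalComplement`, `isSpacelikeSeparated_of_far`, `WightmanData.localPolynomials`,
`IsWightmanQFT.exists_adjoint_mem_localPolynomials`,
`IsWightmanQFT.localPolynomials_commute_causalComplement` (`ReehSchliederSeparating`).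
No new definitions.
-/

noncomputable section

open Filter Topology Complex MeasureTheory Set ComplexConjugate
open scoped SchwartzMap InnerProductSpace
open Literature.Analysis.UnboundedOperators

namespace Literature.MathematicalPhysics.QuantumLattice

variable {d : ℕ} {κ : Type*} {W : WightmanData d κ}

/-! ### Translating monomial vectors -/

section Translation

/-- A pure translation acts on test functions by `f ↦ f(· − a)`. [folklore] -/
theorem poincareTest_inl_apply (a x : SpaceTime d) (f : 𝓢(SpaceTime d, ℂ)) :
    poincareTest (SemidirectProduct.inl (Multiplicative.ofAdd a) : PoincareGroup d) f x =
      f (x - a) := by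
  rw [poincareTest_apply]
  simp only [SemidirectProduct.right_inl, SemidirectProduct.left_inl, toAdd_ofAdd]
  rfl

/-- The translate of a compactly supported test function is compactly supported, with support
translated by `a`. [folklore] -/
theorem hasCompactSupport_poincareTest_inl {a : SpaceTime d} {f : 𝓢(SpaceTime d, ℂ)}
    (hf : HasCompactSupport (f : SpaceTime d → ℂ)) :
    HasCompactSupport (poincareTest (SemidirectProduct.inl (Multiplicative.ofAdd a) :
      PoincareGroup d) f : SpaceTime d → ℂ) ∧
    tsupport (poincareTest (SemidirectProduct.inl (Multiplicative.ofAdd a) : PoincareGroup d) f :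
      SpaceTime d → ℂ) ⊆ (fun x => x - a) ⁻¹' tsupport (f : SpaceTime d → ℂ) := by
  have heq : (poincareTest (SemidirectProduct.inl (Multiplicative.ofAdd a) : PoincareGroup d) f :
      SpaceTime d → ℂ) = (f : SpaceTime d → ℂ) ∘ fun x => x - a :=
    funext fun x => poincareTest_inl_apply a x f
  rw [heq]
  exact ⟨hf.comp_homeomorph (Homeomorph.subRight a),
    tsupport_comp_subset_preimage (f : SpaceTime d → ℂ) (continuous_id.sub continuous_const)⟩

/-- **Translating supports into the far region**: if `supp f ⊆ B̄(0, ρ)` and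
`|a⁰| + 2R + 2ρ < ‖a⃗‖`, then `supp f(· − a) ⊆ S_R = {|x⁰| + 2R < ‖x⃗‖}`. [folklore] -/
theorem sub_preimage_subset_far {R ρ : ℝ} {K : Set (SpaceTime d)} (hK : K ⊆ Metric.closedBall 0 ρ)
    {a : SpaceTime d} (ha : |a 0| + 2 * R + 2 * ρ < ‖spaceC d a‖) :
    (fun x => x - a) ⁻¹' K ⊆ {x : SpaceTime d | |x 0| + 2 * R < ‖spaceC d x‖} := by
  intro x hx
  have hy : ‖x - a‖ ≤ ρ := mem_closedBall_zero_iff.1 (hK hx)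
  -- `|y⁰| ≤ ‖y‖` and `‖y⃗‖ ≤ ‖y‖` for `y = x - a` (as in `isSpacelikeSeparated_of_far`)
  have h1 : |(x - a) 0| ≤ ρ := le_trans (by simpa using PiLp.norm_apply_le (x - a) 0) hy
  have h2 : ‖spaceC d (x - a)‖ ≤ ρ := by
    refine le_trans ?_ hy
    have hsq : ‖x - a‖ ^ 2 = ((x - a) 0) ^ 2 + ‖spaceC d (x - a)‖ ^ 2 := by
      rw [EuclideanSpace.real_norm_sq_eq, EuclideanSpace.real_norm_sq_eq, Fin.sum_univ_succ]
      simp [spaceC_apply]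
    refine (sq_le_sq₀ (norm_nonneg _) (norm_nonneg _)).mp ?_
    rw [hsq]
    nlinarith [sq_nonneg ((x - a) 0)]
  have h3 : |x 0| ≤ |a 0| + ρ := by
    have : (x - a) 0 = x 0 - a 0 := by simp
    rw [this] at h1
    have := abs_sub_abs_le_abs_sub (x 0) (a 0)
    linarith
  have h4 : ‖spaceC d a‖ - ρ ≤ ‖spaceC d x‖ := by
    rw [map_sub] at h2
    have := norm_sub_norm_le (spaceC d a) (spaceC d x)
    rw [← norm_neg (spaceC d a - spaceC d x), neg_sub] at this
    linarith
  show |x 0| + 2 * R < ‖spaceC d x‖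
  linarith

/-- The set of translations `{|a⁰| + c < ‖a⃗‖}` is open and, for `d ≥ 1`, nonempty. [folklore] -/
theorem isOpen_nonempty_far [NeZero d] (c : ℝ) :
    IsOpen {a : SpaceTime d | |a 0| + c < ‖spaceC d a‖} ∧
      {a : SpaceTime d | |a 0| + c < ‖spaceC d a‖}.Nonempty := by
  refine ⟨isOpen_lt ((continuous_abs.comp (EuclideanSpace.proj (0 : Fin (d + 1))).continuous).add
      continuous_const) (spaceC d).continuous.norm, ?_⟩
  let e : EuclideanSpace ℝ (Fin d) := PiLp.single 2 (0 : Fin d) (|c| + 1 : ℝ)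
  refine ⟨ofTimeSpace 0 e, ?_⟩
  have he : ‖e‖ = |c| + 1 := by
    rw [PiLp.norm_single, Real.norm_eq_abs, abs_of_nonneg (by positivity)]
  simp only [Set.mem_setOf_eq, ofTimeSpace_apply_zero, spaceC_ofTimeSpace, he, abs_zero, zero_add]
  linarith [le_abs_self c]

end Translation

/-! ### Reeh–Schlieder for far regions and for causal complements of bounded regions -/

section ReehSchlieder

/-- **Step A of the Reeh–Schlieder argument (far regions)**: if `χ` is orthogonal to every
`φ(g₁)⋯φ(gₙ)Ω` with `gᵢ ∈ 𝒟`, `supp gᵢ ⊆ S_R`, then `χ` is orthogonal to every `φ(g₁)⋯φ(gₙ)Ω`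
with `gᵢ ∈ 𝒟` arbitrary: the matrix coefficient `a ↦ ⟪χ, U(a) φ(g₁)⋯φ(gₙ)Ω⟫` vanishes on the
nonempty open set of translations carrying all supports into `S_R` (W2), hence everywhere by the
spectral condition and analytic continuation (`UnitaryRep.matrixCoeff_eq_zero_of_eqOn_isOpen`),
and its value at `a = 0` is `⟪χ, φ(g₁)⋯φ(gₙ)Ω⟫`. [cite: StreaterWightman1964, §4-2 proof of Thm 4-2] -/
theorem IsWightmanQFT.inner_monomialVec_eq_zero_of_far [NeZero d] (hW : IsWightmanQFT W) (R : ℝ)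
    {χ : W.H}
    (hχ : ∀ l : List (κ × 𝓢(SpaceTime d, ℂ)),
      (∀ p ∈ l, HasCompactSupport (p.2 : SpaceTime d → ℂ) ∧
        tsupport (p.2 : SpaceTime d → ℂ) ⊆ {x : SpaceTime d | |x 0| + 2 * R < ‖spaceC d x‖}) →
      ⟪χ, (W.monomialVec l : W.H)⟫_ℂ = 0)
    {l : List (κ × 𝓢(SpaceTime d, ℂ))} (hl : ∀ p ∈ l, HasCompactSupport (p.2 : SpaceTime d → ℂ)) :
    ⟪χ, (W.monomialVec l : W.H)⟫_ℂ = 0 := by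
  -- a common ball for the supports
  have hKc : IsCompact (⋃ p ∈ {q | q ∈ l}, tsupport (p.2 : SpaceTime d → ℂ)) :=
    l.finite_toSet.isCompact_biUnion fun p hp => hl p hp
  obtain ⟨ρ, hρ⟩ := hKc.isBounded.subset_closedBall (0 : SpaceTime d)
  have hsupp : ∀ p ∈ l, tsupport (p.2 : SpaceTime d → ℂ) ⊆ Metric.closedBall 0 ρ :=
    fun p hp => (Set.subset_biUnion_of_mem (s := {q | q ∈ l})
      (u := fun q : κ × 𝓢(SpaceTime d, ℂ) => tsupport (q.2 : SpaceTime d → ℂ))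
      (show p ∈ {q | q ∈ l} from hp)).trans hρ
  -- the matrix coefficient and the open set of good translations
  set ψ : W.H := (W.monomialVec l : W.H) with hψ
  obtain ⟨hAo, hAne⟩ := isOpen_nonempty_far (d := d) (2 * R + 2 * ρ)
  have hA0 : ∀ a ∈ {a : SpaceTime d | |a 0| + (2 * R + 2 * ρ) < ‖spaceC d a‖},
      W.transl.matrixCoeff χ ψ a = 0 := by
    intro a ha
    have ha' : |a 0| + 2 * R + 2 * ρ < ‖spaceC d a‖ := by
      have := ha; simp only [Set.mem_setOf_eq] at this; linarith
    rw [UnitaryRep.matrixCoeff_apply, hψ, ← W.U_inl, hW.U_monomialVec]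
    refine hχ _ fun p hp => ?_
    obtain ⟨q, hq, rfl⟩ := List.mem_map.1 hp
    obtain ⟨hc, hts⟩ := hasCompactSupport_poincareTest_inl (a := a) (hl q hq)
    exact ⟨hc, hts.trans (sub_preimage_subset_far (hsupp q hq) ha')⟩
  have hall := W.transl.matrixCoeff_eq_zero_of_eqOn_isOpen hW.spectral χ ψ hAo hAne hA0 0
  simpa [UnitaryRep.matrixCoeff_apply] using hall

/-- **The Reeh–Schlieder theorem for far regions** (the case of Streater–Wightman (1964), Thm 4-2
with `𝒪 ⊇ S_R = {x : |x⁰| + 2R < ‖x⃗‖}`, space dimension `d ≥ 1`): the vectors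
`φ_{k₁}(g₁)⋯φ_{kₙ}(gₙ)Ω` with all `gᵢ ∈ 𝒟(S_R)` span a dense subspace of `ℋ`. From Step A
(`inner_monomialVec_eq_zero_of_far`) and the density of compactly smeared monomial vectors
(`IsWightmanQFT.eq_zero_of_forall_inner_monomialVec_hasCompactSupport`: density of `𝒟` in `𝒮`,
norm continuity of monomial vectors in each slot, cyclicity of the vacuum W4). [cite: StreaterWightman1964, §4-2 Thm 4-2] -/
theorem IsWightmanQFT.dense_span_monomialVec_far [NeZero d] (hW : IsWightmanQFT W) (R : ℝ) :
    Dense (Submodule.span ℂ {ψ : W.H | ∃ l : List (κ × 𝓢(SpaceTime d, ℂ)),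
      (∀ p ∈ l, HasCompactSupport (p.2 : SpaceTime d → ℂ) ∧
        tsupport (p.2 : SpaceTime d → ℂ) ⊆ {x : SpaceTime d | |x 0| + 2 * R < ‖spaceC d x‖}) ∧
        ψ = (W.fieldMonomial l W.vacuumDom : W.H)} : Set W.H) := by
  set M := Submodule.span ℂ {ψ : W.H | ∃ l : List (κ × 𝓢(SpaceTime d, ℂ)),
      (∀ p ∈ l, HasCompactSupport (p.2 : SpaceTime d → ℂ) ∧
        tsupport (p.2 : SpaceTime d → ℂ) ⊆ {x : SpaceTime d | |x 0| + 2 * R < ‖spaceC d x‖}) ∧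
        ψ = (W.fieldMonomial l W.vacuumDom : W.H)} with hM
  rw [Submodule.dense_iff_topologicalClosure_eq_top, Submodule.topologicalClosure_eq_top_iff,
    Submodule.eq_bot_iff]
  intro χ hχM
  rw [Submodule.mem_orthogonal] at hχM
  -- `χ ⊥` every `𝒟(S_R)` monomial vector
  have hχ : ∀ l : List (κ × 𝓢(SpaceTime d, ℂ)),
      (∀ p ∈ l, HasCompactSupport (p.2 : SpaceTime d → ℂ) ∧
        tsupport (p.2 : SpaceTime d → ℂ) ⊆ {x : SpaceTime d | |x 0| + 2 * R < ‖spaceC d x‖}) →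
      ⟪χ, (W.monomialVec l : W.H)⟫_ℂ = 0 := by
    intro l hl
    have h : ⟪(W.monomialVec l : W.H), χ⟫_ℂ = 0 := hχM _ (Submodule.subset_span ⟨l, hl, rfl⟩)
    rw [← inner_conj_symm, h, map_zero]
  -- hence `χ ⊥` every compactly smeared monomial vector (Step A), and `χ = 0` (density + W4)
  refine hW.eq_zero_of_forall_inner_monomialVec_hasCompactSupport χ fun n k f hf => ?_
  refine hW.inner_monomialVec_eq_zero_of_far R hχ fun p hp => ?_
  obtain ⟨j, rfl⟩ := (List.mem_ofFn' _ p).1 hp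
  exact hf j

/-- **The Reeh–Schlieder theorem for the causal complement of a bounded region**
(Streater–Wightman (1964), Thm 4-2 for `𝒪'`, `𝒪` bounded, space dimension `d ≥ 1`): the vectors
`φ_{k₁}(g₁)⋯φ_{kₙ}(gₙ)Ω` with `gᵢ ∈ 𝒟(𝒪')` span a dense subspace of `ℋ` (`𝒪'` contains a far
region `S_R`, `isSpacelikeSeparated_of_far`). This is the instance of Thm 4-2 used in the proof
of Thm 4-3 for bounded regions. [cite: StreaterWightman1964, §4-2 Thm 4-2] -/
theorem IsWightmanQFT.reeh_schlieder_causalComplement_of_isBounded [NeZero d]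
    (hW : IsWightmanQFT W) {O : Set (SpaceTime d)} (hO : Bornology.IsBounded O) :
    Dense (Submodule.span ℂ {ψ : W.H | ∃ l : List (κ × 𝓢(SpaceTime d, ℂ)),
      (∀ p ∈ l, HasCompactSupport (p.2 : SpaceTime d → ℂ) ∧
        tsupport (p.2 : SpaceTime d → ℂ) ⊆ causalComplement d O) ∧
        ψ = (W.fieldMonomial l W.vacuumDom : W.H)} : Set W.H) := by
  obtain ⟨R, hR⟩ := (Metric.isBounded_iff_subset_closedBall (0 : SpaceTime d)).1 hO
  -- the far region lies in `𝒪'`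
  have hfar : {x : SpaceTime d | |x 0| + 2 * R < ‖spaceC d x‖} ⊆ causalComplement d O := by
    have hopen : IsOpen {x : SpaceTime d | |x 0| + 2 * R < ‖spaceC d x‖} :=
      (isOpen_nonempty_far (d := d) (2 * R)).1
    refine interior_maximal (fun y hy x hx => ?_) hopen
    exact isSpacelikeSeparated_of_far (mem_closedBall_zero_iff.1 (hR hx)) hy
  refine (hW.dense_span_monomialVec_far R).mono ?_
  refine Submodule.span_mono ?_
  rintro ψ ⟨l, hl, rfl⟩
  exact ⟨l, fun p hp => ⟨(hl p hp).1, (hl p hp).2.trans hfar⟩, rfl⟩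

/-- **Streater–Wightman Theorem 4-3 for bounded regions, unconditional** ("If `𝒪` is an open set
for which `𝒪'` is not empty, and `T ∈ 𝒫(𝒪)`, then `TΨ₀ = 0` implies `T = 0`"; Remark 2: "Any
bounded open set `𝒪` has the property that `𝒪'` is non-empty, and so the theorem applies"): for a
Wightman QFT in space dimension `d ≥ 1`, a bounded region `𝒪`, and `T ∈ 𝒫(𝒪)`, `TΨ₀ = 0`
implies `T = 0` on `D`. The printed proof (4-12) — `(Ψ, T†Φ) = (P'TΨ₀, Φ) = 0` for `Ψ = P'Ψ₀`,
`P' ∈ 𝒫(𝒪')`, such `Ψ` dense — with the density supplied by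
`reeh_schlieder_causalComplement_of_isBounded` instead of the named fact `reeh_schlieder`
(compare `IsWightmanQFT.eq_zero_of_mem_localPolynomials_of_isBounded`).
[cite: StreaterWightman1964, §4-2 Thm 4-3] -/
theorem IsWightmanQFT.localPolynomial_eq_zero_of_isBounded [NeZero d] (hW : IsWightmanQFT W)
    {O : Set (SpaceTime d)} (hO : Bornology.IsBounded O) {T : W.dom →ₗ[ℂ] W.dom}
    (hT : T ∈ W.localPolynomials O) (hT0 : T W.vacuumDom = 0) : T = 0 := by
  obtain ⟨T', hT'mem, hadj⟩ := hW.exists_adjoint_mem_localPolynomials hT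
  have hdense := hW.reeh_schlieder_causalComplement_of_isBounded hO
  -- Step 1: `T† Φ = 0` for every `Φ ∈ D`.
  have hstar : ∀ Φ : W.dom, (T' Φ : W.H) = 0 := by
    intro Φ
    refine hdense.eq_zero_of_inner_left (𝕜 := ℂ) fun v hv => ?_
    refine Submodule.span_induction (p := fun v _ => ⟪(T' Φ : W.H), v⟫_ℂ = 0) ?_ ?_ ?_ ?_ hv
    · rintro v ⟨l, hl, rfl⟩
      have hP : W.fieldMonomial l ∈ W.localPolynomials (causalComplement d O) :=
        WightmanData.fieldMonomial_mem_localPolynomials fun p hp => (hl p hp).2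
      have hcomm := hW.localPolynomials_commute_causalComplement hT hP
      rw [← inner_conj_symm, hadj, ← Module.End.mul_apply, hcomm, Module.End.mul_apply, hT0,
        map_zero, Submodule.coe_zero, inner_zero_left, map_zero]
    · exact inner_zero_right _
    · intro v w _ _ hv hw
      rw [inner_add_right, hv, hw, add_zero]
    · intro c v _ hv
      rw [inner_smul_right, hv, mul_zero]
  -- Step 2: `T Ψ = 0` for every `Ψ ∈ D`, by duality against the dense `D`.
  ext Ψ
  have h : (T Ψ : W.H) = 0 := by
    refine hW.dense_dom.eq_zero_of_inner_left (𝕜 := ℂ) fun v hv => ?_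
    have := hadj Ψ ⟨v, hv⟩
    rw [hstar ⟨v, hv⟩, inner_zero_right] at this
    exact this.symm
  simpa using h

end ReehSchlieder

end Literature.MathematicalPhysics.QuantumLattice
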